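import Summits.NavierStokesRegularity.NavierStokesRegularity.Theses.RellichScar
import Summits.NavierStokesRegularity.NavierStokesRegularity.Theorems.RellichScarSymmetricScarExistsPineauVicolOneSlice
import Summits.NavierStokesRegularity.NavierStokesRegularity.Theorems.RellichScarSymmetricScarExistsGaussianWindowLaw
import Summits.NavierStokesRegularity.NavierStokesRegularity.Theorems.RellichScarSymmetricScarExistsSmallDefectSlice
import Summits.NavierStokesRegularity.NavierStokesRegularity.Theorems.RellichScarSymmetricScarExistsOneSliceCriterion
import Summits.NavierStokesRegularity.NavierStokesRegularity.Theorems.RellichScarSymmetricScarExistsApexLerayProfile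
import Summits.NavierStokesRegularity.NavierStokesRegularity.Theorems.RellichScarSymmetricScarExistsApexClassicalRepresentative
import Summits.NavierStokesRegularity.NavierStokesRegularity.Theorems.RellichScarSymmetricScarExistsApexScaleInvariantBoundsTimeDecay
import Summits.NavierStokesRegularity.NavierStokesRegularity.Theorems.RellichScarSymmetricScarExistsTypeITimeDerivDecay

/-!
# Crux `SymmetricScarExists` (stmt-NavierStokesRegularity-11718), line `logtime-bernoulli-certificate`:
# the TRANSFER theorem — the line's bet proves the route TARGET `NoApexTypeIProfile` (and hence the crux)

Helper file of the line lead (continuation lead c2; `--supports stmt-NavierStokesRegularity-11718`; theorems only,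
no definitions, no named-fact hypotheses).  The line's skeleton
(`Cruxes/SymmetricScarExists/Lines/logtime_bernoulli_certificate.lean`, v4) has ALL its known-mathematics stubs
landed as tree theorems — `stub_apexClassicalRepresentative` (p74461), `stub_apexScaleInvariantBounds_ofTimeDerivDecay`
(p87966, with p75084 p76080 p77049 p78247 p78405), `stub_typeITimeDerivDecay` (p91030),
`apexLerayProfile_of_representative_of_bounds` (p73111/p73412), `stub_oneSliceCriterion` (p72457),
`stub_pineauVicolOneSlice` (p71896), `stub_smallDefectSlice` (p72305), `stub_gaussianWindowLaw` (p72992/p73327) —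
so its composition is a theorem of the tree, recorded here with the bet as an explicit hypothesis in each of its
three registered strengths (statements verbatim = the registered stubs `stub_oneGoodSlice`,
`stub_finiteGaussianAction`, `stub_logtimeBernoulliCertificate`):

* `apexLerayProfile_holds` — the apex ⇒ backward-Leray DICTIONARY, now unconditional: a singular apex Type-I
  profile is a.e. the physical field of an ETERNAL classical backward-Leray profile `(U, P)` in the weighted
  class `LB(C, K)` (eight scale-invariant bounds), origin still singular.
* `noApexTypeIProfile_of_oneGoodSlice` — **weakest bet ⇒ TARGET**: if every member of `LB(C, K)` has, for all
  `δ, R > 0`, ONE slice `s̄` with `‖∂ₛU(s̄, ·)‖ ≤ δ` on `B_R`, then NO singular apex Type-I profile exists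
  (Pineau–Vicol's one-slice ε-regularity, Thm 1.9, read through the dictionary).
* `symmetricScarExists_of_oneGoodSlice` — hence the bet proves the crux, VACUOUSLY (its antecedent class is
  emptied): the line is a line for the target `X`, not a selection of a symmetric scar.
* `noApexTypeIProfile_of_finiteGaussianAction`, `noApexTypeIProfile_of_logtimeBernoulliCertificate` — the same
  for the two stronger registered forms of the bet (finite Gaussian action of `∂ₛU`; the log-time Lyapunov
  certificate, via the landed Gaussian window law).
* `oneGoodSlice_sandwich` — calibration: `X ⇒ crux` trivially and bet ⇒ `X`, so the bet is AT LEAST as strong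
  as the route target (three drefute generations: "X-equivalent"; false in the periodic / λ-DSS world,
  `Negative/OneGoodSlicePeriodicWorld`, p82511).

References: B. Pineau, V. Vicol, arXiv:2607.09619 (2026), Thm 1.9 [PineauVicol2026]; G. Koch, N. Nadirashvili,
G. Seregin, V. Šverák, Acta Math. 203 (2009), Prop. 4.1, Thm 6.1 [KNSS2009]; D. Albritton, T. Barker,
arXiv:1811.00502, §3 [AlbrittonBarker2019].
-/

noncomputable section

open MeasureTheory Set Function Filter Topology TopologicalSpace Metric
open scoped NNReal ENNReal

namespace Summit.NavierStokesRegularity.NavierStokesRegularity.Theorems.SymmetricScarExists.LogtimeBernoulli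

open Literature.Analysis.FluidPDE
open Summit.NavierStokesRegularity.NavierStokesRegularity.Theses.RellichScar

set_option linter.dupNamespace false

/-- **The apex ⇒ backward-Leray dictionary, unconditional**: a singular apex Type-I profile agrees a.e. on the
slab with the physical field `ofLerayOrbit U` of an eternal classical backward-Leray profile `(U, P)` in the
weighted class `LB(C, K)`, and the origin is still backward-singular for that field.  Composition of the landed
`apexLerayProfile_of_representative_of_bounds` with the landed classical representative and the landed
scale-invariant bounds (`stub_apexScaleInvariantBounds_ofTimeDerivDecay stub_typeITimeDerivDecay`).
[cite: KochNadirashviliSereginSverak2009, Prop. 4.1 and Thm. 6.1; AlbrittonBarker2019, §3] -/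
theorem apexLerayProfile_holds :
    ∀ (u : ℝ → EuclideanSpace ℝ (Fin 3) → EuclideanSpace ℝ (Fin 3)) (p : ℝ → EuclideanSpace ℝ (Fin 3) → ℝ) (G : ℝ → EuclideanSpace ℝ (Fin 3) → EuclideanSpace ℝ (Fin 3) →L[ℝ] EuclideanSpace ℝ (Fin 3)) (C : ℝ), Literature.Analysis.FluidPDE.IsSuitableWeakSolutionOn (Literature.Analysis.FluidPDE.slab (EuclideanSpace ℝ (Fin 3)) (Set.Iio 0) isOpen_Iio) 1 0 u p → Literature.Analysis.FluidPDE.HasWeakSpatialGradientOn (Literature.Analysis.FluidPDE.slab (EuclideanSpace ℝ (Fin 3)) (Set.Iio 0) isOpen_Iio) u G → Literature.Analysis.FluidPDE.typeIBound (Set.Iio (0 : ℝ) ×ˢ Set.univ) u p G < ⊤ → Literature.Analysis.FluidPDE.HasTypeIDecay C u → Literature.Analysis.FluidPDE.IsBackwardSingularPoint u 0 → ∃ (U : ℝ → EuclideanSpace ℝ (Fin 3) → EuclideanSpace ℝ (Fin 3)) (P : ℝ → EuclideanSpace ℝ (Fin 3) → ℝ) (K : ℝ), (Literature.Analysis.FluidPDE.IsBackwardLeraySolutionOn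 (Set.univ : Set ℝ) 1 U P ∧ ∀ (s : ℝ) (y : EuclideanSpace ℝ (Fin 3)), (1 + ‖y‖) * ‖U s y‖ ≤ C ∧ (1 + ‖y‖) ^ 2 * ‖fderiv ℝ (U s) y‖ ≤ K ∧ (1 + ‖y‖) ^ 3 * ‖iteratedFDeriv ℝ 2 (U s) y‖ ≤ K ∧ (1 + ‖y‖) ^ 2 * |P s y| ≤ K ∧ (1 + ‖y‖) ^ 3 * ‖gradient (P s) y‖ ≤ K ∧ (1 + ‖y‖) * ‖Literature.Analysis.FluidPDE.timeDerivWithin (Set.univ : Set ℝ) U s y‖ ≤ K ∧ (1 + ‖y‖) ^ 2 * ‖fderiv ℝ (fun z => Literature.Analysis.FluidPDE.timeDerivWithin (Set.univ : Set ℝ) U s z) y‖ ≤ K ∧ (1 + ‖y‖) ^ 3 * ‖Literature.Analysis.FluidPDE.timeDerivWithin (Set.univ : Set ℝ) U s y + (1 / 2 : ℝ) • U s y + (1 / 2 : ℝ) • fderiv ℝ (U s) y y‖ ≤ K) ∧ (Function.uncurry (Literature.Analysis.FluidPDE.ofLerayOrbit U) =ᵐ[MeasureTheory.volume.restrict (Set.Iio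 (0 : ℝ) ×ˢ (Set.univ : Set (EuclideanSpace ℝ (Fin 3))))] Function.uncurry u) ∧ Literature.Analysis.FluidPDE.IsBackwardSingularPoint (Literature.Analysis.FluidPDE.ofLerayOrbit U) 0 :=
  apexLerayProfile_of_representative_of_bounds stub_apexClassicalRepresentative
    (stub_apexScaleInvariantBounds_ofTimeDerivDecay stub_typeITimeDerivDecay)

/-- **Weakest bet ⇒ route TARGET.**  If every eternal backward-Leray profile in the weighted class `LB(C, K)`
has, for all `δ, R > 0`, one slice `s̄` with `‖∂ₛU(s̄, y)‖ ≤ δ` for `‖y‖ < R` (the registered stub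
`stub_oneGoodSlice` of line `logtime-bernoulli-certificate`, verbatim), then no suitable weak solution on
`ℝ³ × (−∞, 0)` with `𝐈 < ∞` and the space–time Type-I bound is singular at the origin: the dictionary
`apexLerayProfile_holds` produces a member of `LB(C, K)` with singular origin, the bet a good slice at the
radius/level of the one-slice criterion (`stub_oneSliceCriterion stub_pineauVicolOneSlice`), which then makes the
origin regular. [cite: PineauVicol2026, Theorem 1.9 (arXiv:2607.09619 p. 8)] -/
theorem noApexTypeIProfile_of_oneGoodSlice :
    (∀ (C K : ℝ) (U : ℝ → EuclideanSpace ℝ (Fin 3) → EuclideanSpace ℝ (Fin 3)) (P : ℝ → EuclideanSpace ℝ (Fin 3) → ℝ), (Literature.Analysis.FluidPDE.IsBackwardLeraySolutionOn (Set.univ : Set ℝ) 1 U P ∧ ∀ (s : ℝ) (y : EuclideanSpace ℝ (Fin 3)), (1 + ‖y‖) * ‖U s y‖ ≤ C ∧ (1 + ‖y‖) ^ 2 * ‖fderiv ℝ (U s) y‖ ≤ K ∧ (1 + ‖y‖) ^ 3 * ‖iteratedFDeriv ℝ 2 (U s) y‖ ≤ K ∧ (1 + ‖y‖) ^ 2 *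 |P s y| ≤ K ∧ (1 + ‖y‖) ^ 3 * ‖gradient (P s) y‖ ≤ K ∧ (1 + ‖y‖) * ‖Literature.Analysis.FluidPDE.timeDerivWithin (Set.univ : Set ℝ) U s y‖ ≤ K ∧ (1 + ‖y‖) ^ 2 * ‖fderiv ℝ (fun z => Literature.Analysis.FluidPDE.timeDerivWithin (Set.univ : Set ℝ) U s z) y‖ ≤ K ∧ (1 + ‖y‖) ^ 3 * ‖Literature.Analysis.FluidPDE.timeDerivWithin (Set.univ : Set ℝ) U s y + (1 / 2 : ℝ) • U s y + (1 / 2 : ℝ) • fderiv ℝ (U s) y y‖ ≤ K) → ∀ δ : ℝ, 0 < δ → ∀ R : ℝ, 0 < R → (∃ sbar : ℝ, ∀ y : EuclideanSpace ℝ (Fin 3), ‖y‖ < R → ‖Literature.Analysis.FluidPDE.timeDerivWithin (Set.univ : Set ℝ) U sbar y‖ ≤ δ)) →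
    NoApexTypeIProfile := by
  intro hbet u p G C hsw hwg hI hdec hsing
  obtain ⟨U, P, K, hLB, -, hsingU⟩ := apexLerayProfile_holds u p G C hsw hwg hI hdec hsing
  obtain ⟨δ, hδ, hcrit⟩ := stub_oneSliceCriterion stub_pineauVicolOneSlice C
  obtain ⟨R, hR, hreg⟩ := hcrit K
  obtain ⟨sbar, hsbar⟩ := hbet C K U P hLB δ hδ R hR
  exact hreg U P hLB ⟨sbar, hsbar⟩ hsingU

/-- **Weakest bet ⇒ crux, vacuously**: under the bet the antecedent class of `SymmetricScarExists` is empty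
(`noApexTypeIProfile_of_oneGoodSlice`), so the crux holds without any symmetric scar being selected — the
line is a line for the target. [cite: PineauVicol2026, Theorem 1.9] -/
theorem symmetricScarExists_of_oneGoodSlice :
    (∀ (C K : ℝ) (U : ℝ → EuclideanSpace ℝ (Fin 3) → EuclideanSpace ℝ (Fin 3)) (P : ℝ → EuclideanSpace ℝ (Fin 3) → ℝ), (Literature.Analysis.FluidPDE.IsBackwardLeraySolutionOn (Set.univ : Set ℝ) 1 U P ∧ ∀ (s : ℝ) (y : EuclideanSpace ℝ (Fin 3)), (1 + ‖y‖) * ‖U s y‖ ≤ C ∧ (1 + ‖y‖) ^ 2 * ‖fderiv ℝ (U s) y‖ ≤ K ∧ (1 + ‖y‖) ^ 3 * ‖iteratedFDeriv ℝ 2 (U s) y‖ ≤ K ∧ (1 + ‖y‖) ^ 2 * |P s y| ≤ K ∧ (1 + ‖y‖) ^ 3 * ‖gradient (P s) y‖ ≤ K ∧ (1 + ‖y‖) * ‖Literature.Analysis.FluidPDE.timeDerivWithin (Set.univ : Set ℝ) U s y‖ ≤ K ∧ (1 + ‖y‖) ^ 2 * ‖fderiv ℝ (fun z => Literature.Analysis.FluidPDE.timeDerivWithin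 (Set.univ : Set ℝ) U s z) y‖ ≤ K ∧ (1 + ‖y‖) ^ 3 * ‖Literature.Analysis.FluidPDE.timeDerivWithin (Set.univ : Set ℝ) U s y + (1 / 2 : ℝ) • U s y + (1 / 2 : ℝ) • fderiv ℝ (U s) y y‖ ≤ K) → ∀ δ : ℝ, 0 < δ → ∀ R : ℝ, 0 < R → (∃ sbar : ℝ, ∀ y : EuclideanSpace ℝ (Fin 3), ‖y‖ < R → ‖Literature.Analysis.FluidPDE.timeDerivWithin (Set.univ : Set ℝ) U sbar y‖ ≤ δ)) →
    SymmetricScarExists := by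
  intro hbet C hex
  obtain ⟨u, p, G, hsw, hwg, hI, hdec, hsing⟩ := hex
  exact absurd hsing (noApexTypeIProfile_of_oneGoodSlice hbet u p G C hsw hwg hI hdec)

/-- **Stronger bet (finite Gaussian action, the card's transfer target `C⁺`) ⇒ route TARGET**, through the
landed `stub_smallDefectSlice` (finite action + weighted Lipschitz bound ⇒ one good slice). [cite: PineauVicol2026, Theorem 1.9] -/
theorem noApexTypeIProfile_of_finiteGaussianAction :
    (∀ (C K : ℝ) (U : ℝ → EuclideanSpace ℝ (Fin 3) → EuclideanSpace ℝ (Fin 3)) (P : ℝ → EuclideanSpace ℝ (Fin 3) → ℝ), (Literature.Analysis.FluidPDE.IsBackwardLeraySolutionOn (Set.univ : Set ℝ) 1 U P ∧ ∀ (s : ℝ) (y : EuclideanSpace ℝ (Fin 3)), (1 + ‖y‖) * ‖U s y‖ ≤ C ∧ (1 + ‖y‖) ^ 2 * ‖fderiv ℝ (U s) y‖ ≤ K ∧ (1 + ‖y‖) ^ 3 * ‖iteratedFDeriv ℝ 2 (U s) y‖ ≤ K ∧ (1 + ‖y‖) ^ 2 * |P s y| ≤ K ∧ (1 + ‖y‖)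 ^ 3 * ‖gradient (P s) y‖ ≤ K ∧ (1 + ‖y‖) * ‖Literature.Analysis.FluidPDE.timeDerivWithin (Set.univ : Set ℝ) U s y‖ ≤ K ∧ (1 + ‖y‖) ^ 2 * ‖fderiv ℝ (fun z => Literature.Analysis.FluidPDE.timeDerivWithin (Set.univ : Set ℝ) U s z) y‖ ≤ K ∧ (1 + ‖y‖) ^ 3 * ‖Literature.Analysis.FluidPDE.timeDerivWithin (Set.univ : Set ℝ) U s y + (1 / 2 : ℝ) • U s y + (1 / 2 : ℝ) • fderiv ℝ (U s) y y‖ ≤ K) → (∃ A : ℝ, ∀ s₁ s₂ : ℝ, s₁ ≤ s₂ → (∫ σ in s₁..s₂, (∫ y : EuclideanSpace ℝ (Fin 3), ‖Literature.Analysis.FluidPDE.timeDerivWithin (Set.univ : Set ℝ) U σ y‖ ^ 2 * Literature.Analysis.FluidPDE.PineauVicol2026.gaussWeight y)) ≤ A)) →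
    NoApexTypeIProfile := fun hact =>
  noApexTypeIProfile_of_oneGoodSlice fun C K U P hLB δ hδ R hR =>
    stub_smallDefectSlice C K U P hLB (hact C K U P hLB) δ hδ R hR

/-- **Strongest bet (the log-time Lyapunov certificate) ⇒ route TARGET**: a bounded slice functional whose
drop dominates the Gaussian action gives `c · Act(s₁, s₂) ≤ V(s₁) − V(s₂) ≤ 2B`, i.e. a finite Gaussian
action (the window-law hypothesis of the certificate is the landed `stub_gaussianWindowLaw`). [cite: PineauVicol2026, Theorem 1.9 and (7.7)] -/
theorem noApexTypeIProfile_of_logtimeBernoulliCertificate :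
    (∀ (C K : ℝ), ∃ (V : (EuclideanSpace ℝ (Fin 3) → EuclideanSpace ℝ (Fin 3)) → (EuclideanSpace ℝ (Fin 3) → ℝ) → ℝ) (c B : ℝ), 0 < c ∧ ∀ (U : ℝ → EuclideanSpace ℝ (Fin 3) → EuclideanSpace ℝ (Fin 3)) (P : ℝ → EuclideanSpace ℝ (Fin 3) → ℝ), (Literature.Analysis.FluidPDE.IsBackwardLeraySolutionOn (Set.univ : Set ℝ) 1 U P ∧ ∀ (s : ℝ) (y : EuclideanSpace ℝ (Fin 3)), (1 + ‖y‖) * ‖U s y‖ ≤ C ∧ (1 + ‖y‖) ^ 2 * ‖fderiv ℝ (U s) y‖ ≤ K ∧ (1 + ‖y‖) ^ 3 * ‖iteratedFDeriv ℝ 2 (U s) y‖ ≤ K ∧ (1 + ‖y‖) ^ 2 * |P s y| ≤ K ∧ (1 + ‖y‖) ^ 3 * ‖gradient (P s) y‖ ≤ K ∧ (1 + ‖y‖) * ‖Literature.Analysis.FluidPDE.timeDerivWithin (Set.univ : Set ℝ) U s y‖ ≤ K ∧ (1 + ‖y‖) ^ 2 * ‖fderiv ℝ (fun z => Literature.Analysis.FluidPDE.timeDerivWithin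 (Set.univ : Set ℝ) U s z) y‖ ≤ K ∧ (1 + ‖y‖) ^ 3 * ‖Literature.Analysis.FluidPDE.timeDerivWithin (Set.univ : Set ℝ) U s y + (1 / 2 : ℝ) • U s y + (1 / 2 : ℝ) • fderiv ℝ (U s) y y‖ ≤ K) → ((∀ s : ℝ, (∫ y : EuclideanSpace ℝ (Fin 3), ‖U s y‖ ^ 2 * Literature.Analysis.FluidPDE.PineauVicol2026.gaussWeight y) ≤ C ^ 2 * (∫ y : EuclideanSpace ℝ (Fin 3), Literature.Analysis.FluidPDE.PineauVicol2026.gaussWeight y)) ∧ ∀ s₁ s₂ : ℝ, s₁ ≤ s₂ → (1 / 2 : ℝ) * (∫ y : EuclideanSpace ℝ (Fin 3), ‖U s₂ y‖ ^ 2 * Literature.Analysis.FluidPDE.PineauVicol2026.gaussWeight y) - (1 / 2 : ℝ) * (∫ y : EuclideanSpace ℝ (Fin 3), ‖U s₁ y‖ ^ 2 * Literature.Analysis.FluidPDE.PineauVicol2026.gaussWeight y) = -(∫ σ in s₁..s₂, ((∫ y : EuclideanSpace ℝ (Fin 3), Literature.Analysis.FluidPDE.frobeniusNormSq (fderiv ℝ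 (U σ) y) * Literature.Analysis.FluidPDE.PineauVicol2026.gaussWeight y) + (1 / 2 : ℝ) * (∫ y : EuclideanSpace ℝ (Fin 3), ‖U σ y‖ ^ 2 * Literature.Analysis.FluidPDE.PineauVicol2026.gaussWeight y) + (1 / 2 : ℝ) * (∫ y : EuclideanSpace ℝ (Fin 3), (P σ y + (1 / 2 : ℝ) * ‖U σ y‖ ^ 2) * inner ℝ y (U σ y) * Literature.Analysis.FluidPDE.PineauVicol2026.gaussWeight y)))) → (∀ s : ℝ, |V (U s) (P s)| ≤ B) ∧ ∀ s₁ s₂ : ℝ, s₁ ≤ s₂ → c * (∫ σ in s₁..s₂, (∫ y : EuclideanSpace ℝ (Fin 3), ‖Literature.Analysis.FluidPDE.timeDerivWithin (Set.univ : Set ℝ) U σ y‖ ^ 2 * Literature.Analysis.FluidPDE.PineauVicol2026.gaussWeight y)) ≤ V (U s₁) (P s₁) - V (U s₂) (P s₂)) →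
    NoApexTypeIProfile := by
  intro hcert
  refine noApexTypeIProfile_of_finiteGaussianAction fun C K U P hLB => ?_
  obtain ⟨V, c, B, hc, hcert'⟩ := hcert C K
  obtain ⟨hV, hdrop⟩ := hcert' U P hLB (stub_gaussianWindowLaw C K U P hLB)
  refine ⟨2 * B / c, fun s₁ s₂ hs => ?_⟩
  have h1 := hdrop s₁ s₂ hs
  have h2 : V (U s₁) (P s₁) - V (U s₂) (P s₂) ≤ 2 * B := by
    have ha := hV s₁
    have hb := hV s₂
    rw [abs_le] at ha hb
    linarith
  rw [le_div_iff₀ hc]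
  linarith

/-- **Calibration — the bet is sandwiched between the target and the crux**: `X ⇒ crux` (vacuity) and
bet ⇒ `X` (`noApexTypeIProfile_of_oneGoodSlice`); so proving the weakest bet of this line proves Type-I
exclusion `NoApexTypeIProfile` outright.  (In the periodic / λ-DSS world the bet is false:
`Negative.not_oneGoodSliceStatement_of_periodic_world'`.) [cite: PineauVicol2026, Theorem 1.9] -/
theorem oneGoodSlice_sandwich :
    ((∀ (C K : ℝ) (U : ℝ → EuclideanSpace ℝ (Fin 3) → EuclideanSpace ℝ (Fin 3)) (P : ℝ → EuclideanSpace ℝ (Fin 3) → ℝ), (Literature.Analysis.FluidPDE.IsBackwardLeraySolutionOn (Set.univ : Set ℝ) 1 U P ∧ ∀ (s : ℝ) (y : EuclideanSpace ℝ (Fin 3)), (1 + ‖y‖) * ‖U s y‖ ≤ C ∧ (1 + ‖y‖) ^ 2 * ‖fderiv ℝ (U s) y‖ ≤ K ∧ (1 + ‖y‖) ^ 3 * ‖iteratedFDeriv ℝ 2 (U s) y‖ ≤ K ∧ (1 + ‖y‖) ^ 2 * |P s y| ≤ K ∧ (1 + ‖y‖) ^ 3 * ‖gradient (P s) y‖ ≤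 K ∧ (1 + ‖y‖) * ‖Literature.Analysis.FluidPDE.timeDerivWithin (Set.univ : Set ℝ) U s y‖ ≤ K ∧ (1 + ‖y‖) ^ 2 * ‖fderiv ℝ (fun z => Literature.Analysis.FluidPDE.timeDerivWithin (Set.univ : Set ℝ) U s z) y‖ ≤ K ∧ (1 + ‖y‖) ^ 3 * ‖Literature.Analysis.FluidPDE.timeDerivWithin (Set.univ : Set ℝ) U s y + (1 / 2 : ℝ) • U s y + (1 / 2 : ℝ) • fderiv ℝ (U s) y y‖ ≤ K) → ∀ δ : ℝ, 0 < δ → ∀ R : ℝ, 0 < R → (∃ sbar : ℝ, ∀ y : EuclideanSpace ℝ (Fin 3), ‖y‖ < R → ‖Literature.Analysis.FluidPDE.timeDerivWithin (Set.univ : Set ℝ) U sbar y‖ ≤ δ)) → NoApexTypeIProfile) ∧ (NoApexTypeIProfile → SymmetricScarExists) :=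
  ⟨noApexTypeIProfile_of_oneGoodSlice, fun hX C hex => by
    obtain ⟨u, p, G, hsw, hwg, hI, hdec, hsing⟩ := hex
    exact absurd hsing (hX u p G C hsw hwg hI hdec)⟩

end Summit.NavierStokesRegularity.NavierStokesRegularity.Theorems.SymmetricScarExists.LogtimeBernoulli

end
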